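import Literature.NumberTheory.LFunctions.ChebyshevCostaPereira68Scheme
import HarnessLib

/-!
# A Costa Pereira-type `m = 68` Chebyshev scheme, part 3/4: kernel chunks 7–9 of the pointwise comparison

Topic `Literature/NumberTheory/LFunctions`; namespace `Literature.NumberTheory.LFunctions.CostaPereira68`.  Pure proof file (kernel computation,
nothing asserted, no definition): `chkAll_7` … `chkAll_9` — the pointwise check `F r ≤ w_L r ∧ w_U r ≤ F r`
(`Literature.NumberTheory.LFunctions.CostaPereira68.chk`, part 1) on `r ∈ [21001, 30000)`, by `decide +kernel`;
independent of part 2 (both import part 1; part 4 assembles the ten chunks into `F_le_wL`, `wU_le_F`).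
Method: Costa Pereira, Acta Arith. 52 (1989), §2 (2.11)–(2.14) [CostaPereira1989]; design and certificate:
cell `parity-ideate` p5 ROUND-44 (port, verbatim).

## References
* N. Costa Pereira, Acta Arith. 52 (1989), 307–337, §2 (2.11)–(2.14), p. 316. [CostaPereira1989]
-/

namespace Literature.NumberTheory.LFunctions.CostaPereira68

/-- Kernel certificate chunk 7: `chk` holds for `3000` consecutive arguments from `21001`. [cite: CostaPereira1989, (2.11)–(2.12) (pointwise comparison of `F` with the block weights; kernel certificate of this file's design)] -/
theorem chkAll_7 : chkAll 21001 3000 = true := by decide +kernel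

/-- Kernel certificate chunk 8: `chk` holds for `3000` consecutive arguments from `24001`. [cite: CostaPereira1989, (2.11)–(2.12) (pointwise comparison of `F` with the block weights; kernel certificate of this file's design)] -/
theorem chkAll_8 : chkAll 24001 3000 = true := by decide +kernel

/-- Kernel certificate chunk 9: `chk` holds for `3000` consecutive arguments from `27001` (2999 from 27001). [cite: CostaPereira1989, (2.11)–(2.12) (pointwise comparison of `F` with the block weights; kernel certificate of this file's design)] -/
theorem chkAll_9 : chkAll 27001 2999 = true := by decide +kernel

end Literature.NumberTheory.LFunctions.CostaPereira68
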